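import Summits.BirchSwinnertonDyer.Rank1Residual.P2.EmptyCellsAtTwo
import Summits.BirchSwinnertonDyer.Rank1Residual.X5.RationalTwoTorsionPoints
import Literature.NumberTheory.EllipticCurves.TwoAdicImageSurjectivityModFourProofs
import Summits.BirchSwinnertonDyer.BirchSwinnertonDyer.Theorems.ByReductionTypeAtTwoSupersingularColemanClass107217l
import Summits.BirchSwinnertonDyer.BirchSwinnertonDyer.Theorems.ByReductionTypeAtTwoSupersingularColemanClass184041bk
import HarnessLib

/-!
# Crux `SupersingularRankZeroAtTwo` (item stmt-BirchSwinnertonDyer-19097, route ByReductionTypeAtTwo, rung K4):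
# the `2`-ADIC IMAGE at a good supersingular `2` is decided by the `j`-invariant ALONE —
# `ρ_{E,2^∞}` onto `GL₂(ℤ₂)` **iff** `j(E) ≠ −4t³(t + 8)` for every `t ∈ ℚ` (UNCONDITIONAL)

Seat `bsd-2adic-ss-1x` (GEN 2, WIDTH-LEVER second prover lane on 19097; cell `bsd-2adic`,
run/shared/lean/pub/bsd-2adic/). HONEST FRAMING (HUMAN RULINGS D-0036/D-0054/D-0074): THEOREMS ONLY; no
definition, no named fact, no instance; closes no item; BSD is NOT proved by any of this. PARTITION (D-0054):
X5@2 good-SUPERSINGULAR row (all traces; in particular the `a₂ = 0` sub-row of 19097's line `signed_halves_two`,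
which SPLITS on the binder `TwoAdicSurjective W` — stubs `stub_zeroMuPlusOfNonSurj` / `stub_pmMuFlatOfNonSurj` of
skeleton v9 carry `¬ TwoAdicSurjective W`) × `p = 2` — types-the-object-of (says exactly WHICH curves sit in the
non-surjective branch).

WHAT IS PROVED (every hypothesis is `GoodSS W 2` on a globally minimal elliptic `W/ℚ`; no PRINT binder — the
Dokchitser–Dokchitser criterion is the tree THEOREM `DokchitserDokchitser2012_surjective_mod_two_four_eight_holds`
and the mod-`8` ⟹ `2`-adic lift is the tree THEOREM `hasSurjectiveModNGaloisRep_two_pow_of_eight_holds`):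

* §1 `Δ_min ≡ 5 (mod 8)` (tree: `minimalDiscriminantInt_emod_eight_eq_five_of_goodSS_two`) kills ALL FOUR square
  conditions of the criterion at once: none of `Δ, −Δ, 2Δ, −2Δ` is a rational square
  (`not_isSquare_neg_Δ_of_goodSS_two`, `…two_mul_Δ…`, `…neg_two_mul_Δ…`; `Δ` itself is the tree's
  `P2.not_isSquare_Δ_of_goodSS_two`), and `E(ℚ)[2] = 0` is the tree's `P2.irr_two_of_goodSS_two`.
* §2 Hence: `ρ̄_{E,2}` is ONTO `GL₂(𝔽₂) ≅ S₃` (`hasSurjectiveModNGaloisRep_two_of_goodSS_two`, the tree's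
  `P2.surj_two_of_goodSS_two` with its `hDD` binder discharged); `ρ̄_{E,4}` onto ⟺ `∀ t, j ≠ −4t³(t+8)`
  (`hasSurjectiveModNGaloisRep_four_iff_of_goodSS_two`); `ρ̄_{E,8}` onto ⟺ `ρ̄_{E,4}` onto
  (`hasSurjectiveModNGaloisRep_eight_iff_four_of_goodSS_two`); and the habitat binder
  **`TwoAdicSurjective W ↔ ∀ t : ℚ, W.j ≠ −4t³(t + 8)`** (`twoAdicSurjective_iff_forall_j_ne_of_goodSS_two`),
  i.e. the non-surjective branch of the line is EXACTLY the Dokchitser–Dokchitser genus-`0` family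
  (`exists_j_eq_of_not_twoAdicSurjective_of_goodSS_two`). For any elliptic `W/ℚ` (no reduction hypothesis)
  an exceptional `j` forbids surjectivity (`not_twoAdicSurjective_of_j_eq`).
* §3 The two X5@2 `a₂ = 0` rank-`0` classes with exceptional `j` (lane A's `j_107217l1_eq_exceptional`,
  `j_184041bk1_eq_exceptional`, `t = −56/121`, `72/13`) are thereby NOT `2`-adically surjective in the kernel
  (`not_twoAdicSurjective_107217l1`, `not_twoAdicSurjective_184041bk1`) — the census bit `NONSURJ-mod4` as a theorem.

References: [DokchitserDokchitserMathZ2012] T. Dokchitser, V. Dokchitser, Math. Z. 272 (2012) 961–964, Theorem (1)–(3);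
[RouseZureickbrown2015] §1 and §3 Lemma; [SilvermanAEC2009] VII.1 (minimal discriminant), III.§1.
-/

set_option autoImplicit false
-- the Theorems namespace of this sub repeats the summit name by design (D-0017 nested layout)
set_option linter.dupNamespace false

noncomputable section

open scoped Classical

open WeierstrassCurve Literature.NumberTheory.EllipticCurves Literature.NumberTheory.EllipticCurves.Rank1Residual
  Summit.BirchSwinnertonDyer.Rank1Residual Summit.BirchSwinnertonDyer.Rank1Residual.X5.O1

namespace Summit.BirchSwinnertonDyer.BirchSwinnertonDyer.Theorems
namespace SSTwoAdicImage

/-! ## §1 `Δ_min ≡ 5 (mod 8)`: no square condition of the criterion can fail -/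

/-- An integer `≡ 2, 3, 5, 6` or `7 (mod 8)` is not a square (squares are `0, 1, 4 mod 8`). [folklore] -/
theorem not_isSquare_int_of_emod_eight {z : ℤ}
    (hz : z % 8 = 2 ∨ z % 8 = 3 ∨ z % 8 = 5 ∨ z % 8 = 6 ∨ z % 8 = 7) : ¬ IsSquare z := by
  rintro ⟨r, hr⟩
  rw [hr, Int.mul_emod] at hz
  have hr8 : r % 8 = 0 ∨ r % 8 = 1 ∨ r % 8 = 2 ∨ r % 8 = 3 ∨ r % 8 = 4 ∨ r % 8 = 5 ∨ r % 8 = 6 ∨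
      r % 8 = 7 := by omega
  rcases hr8 with h8 | h8 | h8 | h8 | h8 | h8 | h8 | h8 <;> rw [h8] at hz <;> omega

variable (W : WeierstrassCurve ℚ) [W.IsElliptic] [W.IsGloballyMinimal]

omit [W.IsElliptic] in
/-- `Δ(W) = Δ_min` (cast of the minimal discriminant; `W` IS its own minimal model). [cite: SilvermanAEC2009, VII.1] -/
theorem intCast_minimalDiscriminantInt_eq_Δ : ((minimalDiscriminantInt W : ℤ) : ℚ) = W.Δ := by
  have := congrArg WeierstrassCurve.Δ (map_integralModelInt W)
  rw [WeierstrassCurve.map_Δ] at this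
  simpa [minimalDiscriminantInt] using this

omit [W.IsElliptic] in
/-- **`−Δ ∉ ℚ^{×2}` at a good supersingular `2`**: `−Δ_min ≡ 3 (mod 8)`. [cite: DokchitserDokchitserMathZ2012, Theorem (2)] -/
theorem not_isSquare_neg_Δ_of_goodSS_two (h : GoodSS W 2) : ¬ IsSquare (-W.Δ) := by
  have h5 := Supersingular.minimalDiscriminantInt_emod_eight_eq_five_of_goodSS_two W h
  have hc : (-W.Δ) = ((-minimalDiscriminantInt W : ℤ) : ℚ) := by
    rw [Int.cast_neg, intCast_minimalDiscriminantInt_eq_Δ]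
  rw [hc, Rat.isSquare_intCast_iff]
  exact not_isSquare_int_of_emod_eight (by omega)

omit [W.IsElliptic] in
/-- **`2Δ ∉ ℚ^{×2}` at a good supersingular `2`**: `2Δ_min ≡ 2 (mod 8)`. [cite: DokchitserDokchitserMathZ2012, Theorem (3)] -/
theorem not_isSquare_two_mul_Δ_of_goodSS_two (h : GoodSS W 2) : ¬ IsSquare (2 * W.Δ) := by
  have h5 := Supersingular.minimalDiscriminantInt_emod_eight_eq_five_of_goodSS_two W h
  have hc : 2 * W.Δ = ((2 * minimalDiscriminantInt W : ℤ) : ℚ) := by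
    rw [Int.cast_mul, Int.cast_ofNat, intCast_minimalDiscriminantInt_eq_Δ]
  rw [hc, Rat.isSquare_intCast_iff]
  exact not_isSquare_int_of_emod_eight (by omega)

omit [W.IsElliptic] in
/-- **`−2Δ ∉ ℚ^{×2}` at a good supersingular `2`**: `−2Δ_min ≡ 6 (mod 8)`. [cite: DokchitserDokchitserMathZ2012, Theorem (3)] -/
theorem not_isSquare_neg_two_mul_Δ_of_goodSS_two (h : GoodSS W 2) : ¬ IsSquare (-2 * W.Δ) := by
  have h5 := Supersingular.minimalDiscriminantInt_emod_eight_eq_five_of_goodSS_two W h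
  have hc : -2 * W.Δ = ((-2 * minimalDiscriminantInt W : ℤ) : ℚ) := by
    rw [Int.cast_mul, intCast_minimalDiscriminantInt_eq_Δ]; norm_num
  rw [hc, Rat.isSquare_intCast_iff]
  exact not_isSquare_int_of_emod_eight (by omega)

/-- **No rational point of order `2` at a good supersingular `2`** (the criterion's first clause), from the tree's
`P2.irr_two_of_goodSS_two`. [cite: DokchitserDokchitserMathZ2012, Theorem (1)] -/
theorem forall_two_nsmul_eq_zero_of_goodSS_two (h : GoodSS W 2) :
    ∀ P : W.toAffine.Point, 2 • P = 0 → P = 0 :=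
  (irr_two_iff_forall_two_nsmul W).mp (P2.irr_two_of_goodSS_two W h)

/-! ## §2 The images `ρ̄_{E,2}`, `ρ̄_{E,4}`, `ρ̄_{E,8}`, `ρ_{E,2^∞}` at a good supersingular `2` -/

/-- **`ρ̄_{E,2}` is onto `GL₂(𝔽₂)` at a good supersingular `2` — UNCONDITIONAL** (the tree's
`P2.surj_two_of_goodSS_two` with the Dokchitser–Dokchitser binder discharged by clause (1), itself the tree theorem
`hasSurjectiveModNGaloisRep_two_iff`). [cite: DokchitserDokchitserMathZ2012, Theorem (1)] -/
theorem hasSurjectiveModNGaloisRep_two_of_goodSS_two (h : GoodSS W 2) : W.HasSurjectiveModNGaloisRep 2 :=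
  (hasSurjectiveModNGaloisRep_two_iff W).mpr
    ⟨forall_two_nsmul_eq_zero_of_goodSS_two W h, P2.not_isSquare_Δ_of_goodSS_two W h⟩

/-- **`ρ̄_{E,4}` onto ⟺ `j ≠ −4t³(t + 8)` for all `t ∈ ℚ`, at a good supersingular `2`.**
[cite: DokchitserDokchitserMathZ2012, Theorem (2)] -/
theorem hasSurjectiveModNGaloisRep_four_iff_of_goodSS_two (h : GoodSS W 2) :
    W.HasSurjectiveModNGaloisRep 4 ↔ ∀ t : ℚ, W.j ≠ -4 * t ^ 3 * (t + 8) := by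
  rw [(DokchitserDokchitser2012_surjective_mod_two_four_eight_holds W).2.1]
  exact ⟨fun h4 ↦ h4.2.2, fun hj ↦ ⟨hasSurjectiveModNGaloisRep_two_of_goodSS_two W h,
    not_isSquare_neg_Δ_of_goodSS_two W h, hj⟩⟩

/-- **`ρ̄_{E,8}` onto ⟺ `ρ̄_{E,4}` onto, at a good supersingular `2`** (the clause-(3) square conditions are idle).
[cite: DokchitserDokchitserMathZ2012, Theorem (3)] -/
theorem hasSurjectiveModNGaloisRep_eight_iff_four_of_goodSS_two (h : GoodSS W 2) :
    W.HasSurjectiveModNGaloisRep 8 ↔ W.HasSurjectiveModNGaloisRep 4 := by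
  rw [(DokchitserDokchitser2012_surjective_mod_two_four_eight_holds W).2.2]
  exact ⟨fun h8 ↦ h8.1, fun h4 ↦ ⟨h4, not_isSquare_two_mul_Δ_of_goodSS_two W h,
    not_isSquare_neg_two_mul_Δ_of_goodSS_two W h⟩⟩

omit [W.IsElliptic] [W.IsGloballyMinimal] in
/-- `ρ_{E,2^∞}` onto ⟹ `ρ̄_{E,4}` onto (level `n = 2` of `TwoAdicSurjective`). [folklore] -/
theorem hasSurjectiveModNGaloisRep_four_of_twoAdicSurjective (him : TwoAdicSurjective W) :
    W.HasSurjectiveModNGaloisRep 4 := by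
  have h2 : W.HasSurjectiveModNGaloisRep ((2 : ℤ) ^ 2) := him 2 (by norm_num)
  have e : ((2 : ℤ) ^ 2) = 4 := by norm_num
  rwa [e] at h2

/-- **THE CRITERION.** For an elliptic curve `E/ℚ` with good supersingular reduction at `2` (globally minimal
model `W`): `ρ_{E,2^∞} : Γ_ℚ → GL₂(ℤ₂)` is surjective **iff** `j(E) ≠ −4t³(t + 8)` for every `t ∈ ℚ`.
(⟸: the tree's unconditional `twoAdicImage_surjective_of_criteria`, all of whose other hypotheses hold by §1;
⟹: level `4` and clause (2).) [cite: DokchitserDokchitserMathZ2012, Theorem (1)–(3)] [cite: RouseZureickbrown2015, §3 Lemma and §1] -/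
theorem twoAdicSurjective_iff_forall_j_ne_of_goodSS_two (h : GoodSS W 2) :
    TwoAdicSurjective W ↔ ∀ t : ℚ, W.j ≠ -4 * t ^ 3 * (t + 8) := by
  constructor
  · intro him
    exact (hasSurjectiveModNGaloisRep_four_iff_of_goodSS_two W h).mp
      (hasSurjectiveModNGaloisRep_four_of_twoAdicSurjective W him)
  · intro hj n _
    exact twoAdicImage_surjective_of_criteria W (forall_two_nsmul_eq_zero_of_goodSS_two W h)
      (P2.not_isSquare_Δ_of_goodSS_two W h) (not_isSquare_neg_Δ_of_goodSS_two W h)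
      (not_isSquare_two_mul_Δ_of_goodSS_two W h) (not_isSquare_neg_two_mul_Δ_of_goodSS_two W h) hj n

/-- **The non-surjective branch is the Dokchitser–Dokchitser family**: at a good supersingular `2`,
`¬ TwoAdicSurjective W ⟺ ∃ t ∈ ℚ, j = −4t³(t + 8)`. [cite: DokchitserDokchitserMathZ2012, Theorem (2)] -/
theorem not_twoAdicSurjective_iff_exists_j_eq_of_goodSS_two (h : GoodSS W 2) :
    ¬ TwoAdicSurjective W ↔ ∃ t : ℚ, W.j = -4 * t ^ 3 * (t + 8) := by
  rw [twoAdicSurjective_iff_forall_j_ne_of_goodSS_two W h]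
  push Not
  exact Iff.rfl

/-- The hypothesis `¬ TwoAdicSurjective W` of the line's non-surjective stubs (`stub_zeroMuPlusOfNonSurj`,
`stub_pmMuFlatOfNonSurj` of 19097's skeleton v9), CASHED: such a curve has `j = −4t³(t + 8)` for some `t ∈ ℚ`.
[cite: DokchitserDokchitserMathZ2012, Theorem (2)] -/
theorem exists_j_eq_of_not_twoAdicSurjective_of_goodSS_two (h : GoodSS W 2) (hns : ¬ TwoAdicSurjective W) :
    ∃ t : ℚ, W.j = -4 * t ^ 3 * (t + 8) :=
  (not_twoAdicSurjective_iff_exists_j_eq_of_goodSS_two W h).mp hns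

omit [W.IsGloballyMinimal] in
/-- **An exceptional `j` forbids `ρ̄_{E,4}` onto — for ANY elliptic `W/ℚ`** (no reduction hypothesis).
[cite: DokchitserDokchitserMathZ2012, Theorem (2)] -/
theorem not_hasSurjectiveModNGaloisRep_four_of_j_eq {t : ℚ} (hj : W.j = -4 * t ^ 3 * (t + 8)) :
    ¬ W.HasSurjectiveModNGaloisRep 4 := fun h4 ↦
  ((DokchitserDokchitser2012_surjective_mod_two_four_eight_holds W).2.1.mp h4).2.2 t hj

omit [W.IsGloballyMinimal] in
/-- **An exceptional `j` forbids a surjective `2`-adic image — for ANY elliptic `W/ℚ`.**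
[cite: DokchitserDokchitserMathZ2012, Theorem (2)] -/
theorem not_twoAdicSurjective_of_j_eq {t : ℚ} (hj : W.j = -4 * t ^ 3 * (t + 8)) : ¬ TwoAdicSurjective W :=
  fun him ↦ not_hasSurjectiveModNGaloisRep_four_of_j_eq W hj
    (hasSurjectiveModNGaloisRep_four_of_twoAdicSurjective W him)

/-! ## §3 The two exceptional X5@2 `a₂ = 0` rank-`0` classes: `107217l`, `184041bk` -/

/-- **`107217l1` is NOT `2`-adically surjective** (`j = −4t³(t + 8)`, `t = −56/121`: lane A's
`j_107217l1_eq_exceptional`). [cite: DokchitserDokchitserMathZ2012, Theorem (2)] [cite: CremonaAlgorithms1997, Table 1] -/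
theorem not_twoAdicSurjective_107217l1 :
    ¬ TwoAdicSurjective ((⟨0, 0, 1, 2592702, -38604175324⟩ : WeierstrassCurve ℤ).baseChange ℚ) := by
  haveI := SSColemanRoad.isElliptic_107217l1
  exact not_twoAdicSurjective_of_j_eq _ SSColemanRoad.j_107217l1_eq_exceptional

/-- **`184041bk1` is NOT `2`-adically surjective** (`j = −4t³(t + 8)`, `t = 72/13`: lane A's
`j_184041bk1_eq_exceptional`). [cite: DokchitserDokchitserMathZ2012, Theorem (2)] [cite: CremonaAlgorithms1997, Table 1] -/
theorem not_twoAdicSurjective_184041bk1 :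
    ¬ TwoAdicSurjective ((⟨0, 0, 1, -36440118, -92277007144⟩ : WeierstrassCurve ℤ).baseChange ℚ) := by
  haveI := SSColemanRoad.isElliptic_184041bk1
  exact not_twoAdicSurjective_of_j_eq _ SSColemanRoad.j_184041bk1_eq_exceptional

end SSTwoAdicImage
end Summit.BirchSwinnertonDyer.BirchSwinnertonDyer.Theorems

end
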